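import Summits.QuantumFields.BalabanUV.T4Continuum.Support.AveragingDeficitCoreAxialPrep

/-!
# LevelZeroFluxGradient (T⁴ programme, node NE3, formalisation swarm row S7 = skeleton leaf A-H0, part 1) —
# THE FLUX AND ITS COVARIANT GRADIENT IN THE SMALL-FIELD CLASS ARE TRIVIALLY BOUNDED: `‖F(p)‖ ≤ 2a`,
# `‖(∇_V F)(x, κ; π)‖ ≤ 4a` for every `U(N)`-valued `V` with `SmallField V a`, `a ≤ 1/4`

HONEST FRAMING (cell `pub-balaban`, T4-DAG PAGE 1; unit `b2b-balaban-t4-ne3-formalise-leaf-05` = NE3 formalisation swarm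
LEAF PROVER 05, row S7 of `t4/formal/NE3/LEAVES.md`, skeleton `t4/b2b-balaban-t4-ne3-p1/SKELETON-NE3-P1.md` v1.1 §3 row
A-H0 «the datum's own level-0 regularity … the flux-gradient clause is TRIVIAL at level 0»).  The cell's T⁴ target is the
finite-torus continuum limit of gauge-invariant observables — NOT infinite volume, NO mass gap, NOT the Clay problem, NOT
summit progress.  NE3 (the η-rate of the minimisers) is NOT proved here or anywhere; its action half (A) is a KERNEL
COMPOSITION conditional on the hypothesis SHAPES (H1) (H3) (H0) (H4) + the kinematic lemma `SmoothRefine` (rows S3–S4,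
R0 of the swarm).  THIS FILE is the scale-free arithmetic behind the trivial leaf (H0): at level `0` the «minimiser» is
the datum `V` itself (owner's `MinimalActionRefine.eq_of_isMinimiser_zero`, p209344 QUEUED), and a datum of the small-field
class (7) has, besides its small plaquette variables, a covariant flux gradient bounded by TWICE the flux bound — no
smoothness is claimed or needed at level `0` (the sup-form regularity shape `RegularSup d L N b c 0 V` then holds with
`b := ε`, `c := 4ε`; that one-line wrapper is part 2, filed when `MinimalActionRefine` is in the tree).

CONTENT (all [folklore], 0 sorry; tree vocabulary only: `T4AveragingDeficitWall.{flux, covGrad, Ad, fhol, SmallField,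
IsUnitaryCfg}`, `AveragingDeficitCoreAxialPrep.norm_flux_le`, `AveragingDeficitTransport.norm_Ad_of_unitary`):
* `norm_fhol_sub_one_le_of_smallField` — (44) read on an indexed plaquette `p = (x; μ < ν)`;
* `norm_flux_le_of_smallField` — `‖F(p)‖ ≤ 2a` (`‖log P‖ ≤ 2‖P − 1‖` on `‖P − 1‖ ≤ 1/2`, B7 (26));
* `norm_covGrad_le_of_unitary` — `‖(∇_V G)(x,κ;π)‖ ≤ ‖G(x+e_κ;π)‖ + ‖G(x;π)‖` for ANY plaquette function `G` and
  `U(N)`-valued `V` (`Ad` is an isometry);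
* **`norm_covGrad_flux_le_of_smallField`** — `‖(∇_V F)(x, κ; π)‖ ≤ 4a`;
* `norm_covGrad_flux_le_level` — the same written at level `j` in the shape of the `grad` field of the owner's
  `RegularSup`: `SmallField V (b/(L^j)^2)` ⇒ `‖∇_V F‖ ≤ (4b(L^j)) / (L^j)^3` (so at `j = 0`: `≤ 4b / 1`).
No hypothesis of any theorem is a printed sentence; no `def … : Prop`; nothing about minimisers.
Context: T. Bałaban, Commun. Math. Phys. **102** (1985) 277–309 [Balaban1985Variational], class (7) p. 278 (the datum
`V ∈ 𝔘(ε₁)`); Commun. Math. Phys. **98** (1985) 17–51 [Balaban1985Averaging], (26) p. 21 (the logarithm bound).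
PLACEMENT: `Summits/QuantumFields/BalabanUV/` (human rule 2026-08-19).  Record: `t4/formal/NE3/LEAVES.md` row S7.
-/

set_option autoImplicit false

open scoped BigOperators Matrix Matrix.Norms.L2Operator
open NormedSpace

namespace Summit.QuantumFields.BalabanUV.T4Continuum.LevelZeroFluxGradient

open Literature.MathematicalPhysics.QuantumFieldTheory.Balaban1983to89
open B7Prop1Explicit B7Prop2Explicit MatrixLog
open T4AveragingDeficitWall hiding Site Plane Plaq Bond
open AveragingDeficitTransport (norm_Ad_of_unitary)
open AveragingDeficitCoreAxialPrep (norm_flux_le)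

noncomputable section

variable {d : ℕ} {n : Type*} [Fintype n] [DecidableEq n]

/-! ## §1 The flux in the small-field class -/

/-- (44) on an indexed plaquette: `SmallField V a` bounds `‖V(∂p) − 1‖ ≤ a` for every `p = (x; μ < ν)`. [folklore] -/
theorem norm_fhol_sub_one_le_of_smallField {V : B7Prop1Explicit.Site d → Fin d → (Matrix n n ℂ)ˣ} {a : ℝ}
    (hVa : SmallField V a)
    (p : T4AveragingDeficitWall.Plaq d) : ‖((fhol V p : (Matrix n n ℂ)ˣ) : Matrix n n ℂ) - 1‖ ≤ a :=
  hVa p.1 p.2.1.1 p.2.1.2 (ne_of_lt p.2.2)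

/-- `‖F(p)‖ ≤ 2a` for every plaquette of a configuration in the small-field class of radius `a ≤ 1/4`
(the flux `F = log V(∂p)`, B7 (21), and `‖log P‖ ≤ 2‖P − 1‖`, B7 (26)). [folklore] -/
theorem norm_flux_le_of_smallField {V : B7Prop1Explicit.Site d → Fin d → (Matrix n n ℂ)ˣ} {a : ℝ}
    (ha : a ≤ 1 / 4) (hVa : SmallField V a)
    (p : T4AveragingDeficitWall.Plaq d) : ‖flux V p‖ ≤ 2 * a :=
  norm_flux_le ha p (norm_fhol_sub_one_le_of_smallField hVa p)

/-! ## §2 The covariant gradient: the trivial bound -/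

/-- For `U(N)`-valued `V` and ANY plaquette function `G`, `‖(∇_V G)(x, κ; π)‖ ≤ ‖G(x + e_κ; π)‖ + ‖G(x; π)‖`
(`∇_V G = Ad_{V(x,κ)} G(x+e_κ) − G(x)` and `Ad` of a unitary is an isometry of the operator norm). [folklore] -/
theorem norm_covGrad_le_of_unitary {V : B7Prop1Explicit.Site d → Fin d → (Matrix n n ℂ)ˣ} (hV : IsUnitaryCfg V)
    (G : T4AveragingDeficitWall.Plaq d → Matrix n n ℂ) (x : B7Prop1Explicit.Site d) (κ : Fin d)
    (π : T4AveragingDeficitWall.Plane d) :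
    ‖covGrad V G x κ π‖ ≤ ‖G (x + e κ, π)‖ + ‖G (x, π)‖ := by
  unfold covGrad
  exact (norm_sub_le _ _).trans (by rw [norm_Ad_of_unitary (hV x κ)])

/-- **The covariant flux gradient in the small-field class is at most twice the flux bound**:
`‖(∇_V F)(x, κ; π)‖ ≤ 4a` for `U(N)`-valued `V` with `SmallField V a`, `a ≤ 1/4`. [folklore] -/
theorem norm_covGrad_flux_le_of_smallField {V : B7Prop1Explicit.Site d → Fin d → (Matrix n n ℂ)ˣ}
    (hV : IsUnitaryCfg V) {a : ℝ}
    (ha : a ≤ 1 / 4) (hVa : SmallField V a) (x : B7Prop1Explicit.Site d) (κ : Fin d)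
    (π : T4AveragingDeficitWall.Plane d) :
    ‖covGrad V (flux V) x κ π‖ ≤ 4 * a := by
  have h1 := norm_flux_le_of_smallField ha hVa (x + e κ, π)
  have h2 := norm_flux_le_of_smallField ha hVa (x, π)
  linarith [norm_covGrad_le_of_unitary hV (flux V) x κ π]

/-- The same at level `j`, in the shape of the `grad` field of the sup-form regularity class: a configuration with
`SmallField V (b/(L^j)^2)`, `b/(L^j)^2 ≤ 1/4`, has `‖(∇_V F)(x,κ;π)‖ ≤ (4b·L^j)/(L^j)^3` (`= 4b/(L^j)^2`; at `j = 0`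
this is `4b`).  No smoothness in the lattice-spacing sense is asserted: the honest `η³` regularity of a MINIMISER is
the content of the swarm's rows S3/S4, not of this bound. [folklore] -/
theorem norm_covGrad_flux_le_level {V : B7Prop1Explicit.Site d → Fin d → (Matrix n n ℂ)ˣ}
    (hV : IsUnitaryCfg V) {L : ℕ} (hL : 1 ≤ L) {b : ℝ}
    (j : ℕ) (hb : b / ((L : ℝ) ^ j) ^ 2 ≤ 1 / 4) (hVa : SmallField V (b / ((L : ℝ) ^ j) ^ 2))
    (x : B7Prop1Explicit.Site d)
    (κ : Fin d) (π : T4AveragingDeficitWall.Plane d) :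
    ‖covGrad V (flux V) x κ π‖ ≤ 4 * b * (L : ℝ) ^ j / ((L : ℝ) ^ j) ^ 3 := by
  have hLj : (0 : ℝ) < (L : ℝ) ^ j := by
    have : (0 : ℝ) < L := by exact_mod_cast hL
    positivity
  have h := norm_covGrad_flux_le_of_smallField hV hb hVa x κ π
  have heq : 4 * b * (L : ℝ) ^ j / ((L : ℝ) ^ j) ^ 3 = 4 * (b / ((L : ℝ) ^ j) ^ 2) := by
    field_simp
  rw [heq]
  exact h

end

end Summit.QuantumFields.BalabanUV.T4Continuum.LevelZeroFluxGradient
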